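import Mathlib
import HarnessLib
import Summits.HubbardSuperconductivity.HubbardSuperconductivity.Theorems.KLProgrammeKLRegimeCountertermJacksonRemainderReadResidueC1TabFitA
import Summits.HubbardSuperconductivity.HubbardSuperconductivity.Theorems.KLProgrammeKLRegimeTwoLegCurvatureConstsJetC2

/-!
# Route `KLProgramme` — ENGINE item stmt-HubbardSuperconductivity-20437 `KLRegimeEngineV17F2`, ROW (C) `stub_twoLeg_curvature` — «(C)-FIRST-STEP-FIT»:
# with the certified `d = 128` record, the SLOPE-KEYED first-step fit rows of the (C) closer's package refute every k = 2 slice constant `≥ 3`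
# (cell gate-hubbard-kl, seat p2 g28; located-candidate memo `HOME/p2-g28/FIRST-STEP-FIT.md`)

WHAT.  The (C) closer's package (`hres′` of …ClosersCGQGuardInst, `hres″` of …ClosersCGQGuardByType) keys the (C1) input of the FIRST flow step
(`m = 0`, Jackson degree `klFlowDeg 0 = 128`) on the slope: `ĉ = (π/2·cc 1, cc 1, cc 2, cc 3, cc 4)` (rows l.130–151 of the tree closer), with ONE
scale-uniform private table `cc` under the ceilings `cc 3 ≤ klC4aJetC2 3 = 16`.  k3c3-p1 g9 typed the UPPER numerals of the record's linear forms
(`klC1TableF128r_fit_*`, …ReadResidueC1TabFitA).  This file proves the matching LOWER numerals (`π > 3.14`; only the `cc 1`, `cc 2` columns are kept)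
and the arithmetic consequence:
* `klC1TableF128r_lower_one/two/three` — `T.bound ĉ 1·4 ≥ 0.8·cc 1 + 0.0227·cc 2`, `T.bound ĉ 2 ≥ 2.05·cc 1 + 0.0478·cc 2`, `T.bound ĉ 3/4 ≥ 45.7·cc 1 + 0.092·cc 2`;
* **`firstStep_slopeKeyed_table128r_contra`** — if the three first-step fit rows `cA₀ₖ + tₖ + eJ₀ₖ ≤ cc k` (`k = 1, 2, 3`; `cA, t ≥ 0`) hold with
  `eJ₀ₖ` above the record's forms at `ĉ`, the k = 2 slice constant is `≥ 3`, and `cc 3 ≤ 16`, then `False`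
  (chain: `cc 1 ≥ 0.1135·cc 2`, `cc 2 ≥ 1.39·cA₀₂ ≥ 4.17`, `cc 3 ≥ 5.27·cc 2 ≥ 22 > 16`).
So NO private table closes the registered first step against a producer with k = 2 slice constant `≥ 3` (natural size of record ≈ 9.1, C4A-PLAN §15.3)
as long as the (C1) input there is slope-keyed on the record `klC1TableF128r`; the cure is the osc-keyed first step of …ReadResidueC1OscFit128 with a
dedicated scale-0 oscillation table (memo §4).  Pure arithmetic on a landed record; nothing here asserts or refutes row (C), any registered row, K3,
U₀, the window or superconductivity in the Hubbard model.  0 kit · 0 lit.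
References: BGM 2006 §2.4 Lemma 2.1 (2.36)–(2.42) [cite: BenfattoGiulianiMastropietro2006].
-/

noncomputable section

namespace Summit.HubbardSuperconductivity.HubbardSuperconductivity.Theorems.EngineV8

set_option linter.dupNamespace false -- summit = problem name (single-conjunct summit), D-0017

open Real
open Summit.HubbardSuperconductivity.HubbardSuperconductivity.Theorems.KLRegimeSplit

/-! ## §1 Lower numerals of the `d = 128` record's first-step linear forms (slope-keyed input, `m = 0`) -/

/-- Row `k = 1`: `T.bound ĉ 1 · 4 ≥ 0.8·cc 1 + 0.0227·cc 2` (`N 1·π/2 + Tu 1 + N0 ≥ 0.2024`, `4·Td = 0.0227`). [cite: BenfattoGiulianiMastropietro2006, §2.4 (2.36)] -/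
theorem klC1TableF128r_lower_one {c : ℕ → ℝ} (hc : ∀ l, 0 ≤ c l) :
    0.8 * c 1 + 0.0227 * c 2 ≤
      klC1TableF128r.bound (fun l : ℕ => if l = 0 then π / 2 * c 1 * (4 : ℝ) ^ ((((1 : ℕ) : ℤ) - 2) * ((0 : ℕ) : ℤ)) else c l * (4 : ℝ) ^ (((l : ℤ) - 2) * ((0 : ℕ) : ℤ))) 1 *
        ((4 : ℝ) ^ ((((1 : ℕ) : ℤ) - 2) * ((0 + 1 : ℕ) : ℤ)))⁻¹ := by
  have hπ := mul_le_mul_of_nonneg_right Real.pi_gt_d2.le (hc 1)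
  have h1 := hc 1; have h2 := hc 2
  norm_num [CutoffDefectTable.bound_one, klC1TableF128r]
  nlinarith [hπ, h1, h2]

/-- Row `k = 2`: `T.bound ĉ 2 ≥ 2.05·cc 1 + 0.0478·cc 2` (`N 2·π/2 + 2Mc[2,1,1] + Tt[2,1] ≥ 2.057`, `Tu 2 + N0 = 0.04787`). [cite: BenfattoGiulianiMastropietro2006, §2.4 (2.36)] -/
theorem klC1TableF128r_lower_two {c : ℕ → ℝ} (hc : ∀ l, 0 ≤ c l) :
    2.05 * c 1 + 0.0478 * c 2 ≤
      klC1TableF128r.bound (fun l : ℕ => if l = 0 then π / 2 * c 1 * (4 : ℝ) ^ ((((1 : ℕ) : ℤ) - 2) * ((0 : ℕ) : ℤ)) else c l * (4 : ℝ) ^ (((l : ℤ) - 2) * ((0 : ℕ) : ℤ))) 2 *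
        ((4 : ℝ) ^ ((((2 : ℕ) : ℤ) - 2) * ((0 + 1 : ℕ) : ℤ)))⁻¹ := by
  have hπ := mul_le_mul_of_nonneg_right Real.pi_gt_d2.le (hc 1)
  have h1 := hc 1; have h2 := hc 2; have h3 := hc 3
  norm_num [CutoffDefectTable.bound_two, klC1TableF128r]
  nlinarith [hπ, h1, h2, h3]

/-- Row `k = 3`: `T.bound ĉ 3 / 4 ≥ 45.7·cc 1 + 0.092·cc 2` (`(N 3·π/2 + 3Mc[3,1,1] + 3Mc[3,2,1] + Tt[3,1])/4 ≥ 45.75`, `(3Mc[3,1,2] + Tt[3,2])/4 = 0.0923`).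
[cite: BenfattoGiulianiMastropietro2006, §2.4 (2.36)] -/
theorem klC1TableF128r_lower_three {c : ℕ → ℝ} (hc : ∀ l, 0 ≤ c l) :
    45.7 * c 1 + 0.092 * c 2 ≤
      klC1TableF128r.bound (fun l : ℕ => if l = 0 then π / 2 * c 1 * (4 : ℝ) ^ ((((1 : ℕ) : ℤ) - 2) * ((0 : ℕ) : ℤ)) else c l * (4 : ℝ) ^ (((l : ℤ) - 2) * ((0 : ℕ) : ℤ))) 3 *
        ((4 : ℝ) ^ ((((3 : ℕ) : ℤ) - 2) * ((0 + 1 : ℕ) : ℤ)))⁻¹ := by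
  have hπ := mul_le_mul_of_nonneg_right Real.pi_gt_d2.le (hc 1)
  have h1 := hc 1; have h2 := hc 2; have h3 := hc 3; have h4 := hc 4
  norm_num [CutoffDefectTable.bound_three, klC1TableF128r]
  nlinarith [hπ, h1, h2, h3, h4]

/-! ## §2 The first step refutes every k = 2 slice constant `≥ 3` under the registered k = 3 ceiling -/

/-- **«(C)-FIRST-STEP-FIT» IN THE KERNEL.**  Private table `cc ≥ 0`; first-step (C1) outputs `e k` above the `d = 128` record's slope-keyed forms
(the closer's rows l.130–135 at `m = 0`, `Tc 0 = klC1TableF128r`); first-step fit rows `a k + t k + e k ≤ cc k` (`k = 1, 2, 3`; slice constants `a k ≥ 0`,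
transport shares `t k ≥ 0`, the closer's rows l.143–151 at `m = 0`); k = 2 slice constant `a 2 ≥ 3`; ceiling `cc 3 ≤ 16` (`= klC4aJetC2 3`).  Then `False`.
[cite: BenfattoGiulianiMastropietro2006, §2.4 Lemma 2.1 (2.36)–(2.42)] -/
theorem firstStep_slopeKeyed_table128r_contra {cc a t e : ℕ → ℝ} (hcc : ∀ l, 0 ≤ cc l) (ha : ∀ k, 0 ≤ a k) (ht : ∀ k, 0 ≤ t k)
    (he1 : klC1TableF128r.bound (fun l : ℕ => if l = 0 then π / 2 * cc 1 * (4 : ℝ) ^ ((((1 : ℕ) : ℤ) - 2) * ((0 : ℕ) : ℤ)) else cc l * (4 : ℝ) ^ (((l : ℤ) - 2) * ((0 : ℕ) : ℤ))) 1 *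
        ((4 : ℝ) ^ ((((1 : ℕ) : ℤ) - 2) * ((0 + 1 : ℕ) : ℤ)))⁻¹ ≤ e 1)
    (he2 : klC1TableF128r.bound (fun l : ℕ => if l = 0 then π / 2 * cc 1 * (4 : ℝ) ^ ((((1 : ℕ) : ℤ) - 2) * ((0 : ℕ) : ℤ)) else cc l * (4 : ℝ) ^ (((l : ℤ) - 2) * ((0 : ℕ) : ℤ))) 2 *
        ((4 : ℝ) ^ ((((2 : ℕ) : ℤ) - 2) * ((0 + 1 : ℕ) : ℤ)))⁻¹ ≤ e 2)
    (he3 : klC1TableF128r.bound (fun l : ℕ => if l = 0 then π / 2 * cc 1 * (4 : ℝ) ^ ((((1 : ℕ) : ℤ) - 2) * ((0 : ℕ) : ℤ)) else cc l * (4 : ℝ) ^ (((l : ℤ) - 2) * ((0 : ℕ) : ℤ))) 3 *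
        ((4 : ℝ) ^ ((((3 : ℕ) : ℤ) - 2) * ((0 + 1 : ℕ) : ℤ)))⁻¹ ≤ e 3)
    (f1 : a 1 + t 1 + e 1 ≤ cc 1) (f2 : a 2 + t 2 + e 2 ≤ cc 2) (f3 : a 3 + t 3 + e 3 ≤ cc 3)
    (hA2 : 3 ≤ a 2) (hceil : cc 3 ≤ 16) : False := by
  have l1 := klC1TableF128r_lower_one hcc
  have l2 := klC1TableF128r_lower_two hcc
  have l3 := klC1TableF128r_lower_three hcc
  have a1 := ha 1; have a3 := ha 3; have t1 := ht 1; have t2 := ht 2; have t3 := ht 3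
  have c1 := hcc 1; have c2 := hcc 2
  -- cc 1 ≥ 0.8 cc 1 + 0.0227 cc 2 ;  cc 2 ≥ 3 + 2.05 cc 1 + 0.0478 cc 2 ;  cc 3 ≥ 45.7 cc 1 + 0.092 cc 2
  have r1 : 0.8 * cc 1 + 0.0227 * cc 2 ≤ cc 1 := by linarith
  have r2 : 3 + 2.05 * cc 1 + 0.0478 * cc 2 ≤ cc 2 := by linarith
  have r3 : 45.7 * cc 1 + 0.092 * cc 2 ≤ cc 3 := by linarith
  nlinarith

/-! ## §3 The DEDICATED keying is feasible: a vacuity screen of the re-keyed package `hres‴` at the first step -/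

/-- **«(C)-FIRST-STEP-FIT», THE CURE'S SCREEN IN THE KERNEL** (pen (R561)(a); companion of `firstStep_slopeKeyed_table128r_contra`).  In the RE-KEYED
package `hres‴` (…EngineV17F2ClosersCGQGuardDedicated) the first step's (C1) rows `heJ₀` read a DEDICATED scale-`0` table `c0` (not the private `cc`), the
fits stay `cA 0 k + t k + eJ 0 k ≤ cc k` with `cc` PRIVATE below the ceilings and `c0 ≤ cc`.  For EVERY dedicated table in the box `c0 1 ≤ 0.1`, `c0 2 ≤ 1`,
`c0 3 ≤ 4`, `c0 4 ≤ 224` (⊇ the records-level `cD(B, sS)` of …ScaleZeroRecordPairDedicated whenever `B 1 ≤ 0.03`, `B 2 ≤ 0.05`, `sS = (3, 220)`), EVERY slice row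
`a ≤ (6, 9.1, 3, 220)` (signs free) (even C4A-PLAN's inflated «natural» sizes; the honest ones are ≈ 130× smaller, K2-FIRST-STEP §1) and transport shares `t ≤ 2⁻¹⁰`, the
m = 0 block is SATISFIABLE: with `cc⋆ := (·, 7, 10, 9, 900)` and `e := S⁽¹²⁸⁾·c0` (k3c3-p1's `klC1TableF128r_eJ_le`) the row family `heJ₀` (VERBATIM shape, `Tc 0 :=
klC1TableF128r`), the four fits, the dominations `c0 k ≤ cc⋆ k` and the ceilings `cc⋆ k ≤ klC4aJetC2 k` (`k = 1 … 4`) all hold.  (The same `cc⋆` also satisfies the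
`m ≥ 1` table rows and the deep rows of the package with these `a, t` — least all-scales solution `(6.6, 9.3, 5.8, 552)`, script `HOME/p2-g28/fit_feasibility.py`,
numeric not kernel; the box extends to `c0 1 ≤ 0.27`, i.e. `B 1 ≲ 0.085`, with `cc⋆ = (·, 7, 10, 15.9, 1900)`.)  So `hres‴` does not inherit the emptiness of
`hres″`/`hres′` at the first step: what it asks of the records is the NUMBER `c0 1 = 3.19·B 1 + δ_A ≲ 0.27`.
[cite: BenfattoGiulianiMastropietro2006, §2.4 Lemma 2.1 (2.36)–(2.42)] -/
theorem firstStep_dedicated_table128r_feasible {c0 a t : ℕ → ℝ} (hc0 : ∀ l, 0 ≤ c0 l)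
    (hc01 : c0 1 ≤ 0.1) (hc02 : c0 2 ≤ 1) (hc03 : c0 3 ≤ 4) (hc04 : c0 4 ≤ 224)
    (ha1 : a 1 ≤ 6) (ha2 : a 2 ≤ 9.1) (ha3 : a 3 ≤ 3) (ha4 : a 4 ≤ 220) (ht' : ∀ k, t k ≤ 1 / 2 ^ 10) :
    ∃ cc e : ℕ → ℝ, (∀ l, 0 ≤ cc l) ∧ e 0 = 0 ∧
      (∀ k ≤ 4,
            (fun k => if k = 0 then 0 else
              (if k ≤ 3 then klC1TableF128r.bound (fun l : ℕ => if l = 0 then π / 2 * c0 1 * (4 : ℝ) ^ ((((1 : ℕ) : ℤ) - 2) * ((0 : ℕ) : ℤ)) else c0 l * (4 : ℝ) ^ (((l : ℤ) - 2) * ((0 : ℕ) : ℤ))) k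
                else klC1TableF128r.boundNR (fun l : ℕ => if l = 0 then π / 2 * c0 1 * (4 : ℝ) ^ ((((1 : ℕ) : ℤ) - 2) * ((0 : ℕ) : ℤ)) else c0 l * (4 : ℝ) ^ (((l : ℤ) - 2) * ((0 : ℕ) : ℤ))) k) *
                ((4 : ℝ) ^ (((k : ℤ) - 2) * ((0 + 1 : ℕ) : ℤ)))⁻¹) k ≤ e k) ∧
      (∀ k, 1 ≤ k → k ≤ 4 → a k + t k + e k ≤ cc k) ∧
      (∀ k, 1 ≤ k → k ≤ 4 → c0 k ≤ cc k ∧ cc k ≤ klC4aJetC2 k) := by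
  refine ⟨fun k => if k = 1 then 7 else if k = 2 then 10 else if k = 3 then 9 else if k = 4 then 900 else c0 k,
    fun k : ℕ => if k = 1 then 0.8105 * c0 1 + 0.02273 * c0 2 else if k = 2 then 2.061 * c0 1 + 0.04792 * c0 2 + 0.005681 * c0 3
      else if k = 3 then 45.82 * c0 1 + 0.09241 * c0 2 + 0.01341 * c0 3 + 0.001421 * c0 4
      else if k = 4 then 5928 * c0 1 + 0.4898 * c0 2 + 0.03347 * c0 3 + 0.1289 * c0 4 else 0, ?_, by norm_num, klC1TableF128r_eJ_le hc0, ?_, ?_⟩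
  · intro l
    have := hc0 l
    dsimp only
    split_ifs <;> linarith [this]
  · intro k hk1 hk4
    have h1 := hc0 1; have h2 := hc0 2; have h3 := hc0 3; have h4 := hc0 4
    have a1 := ha1; have a2 := ha2; have a3 := ha3; have a4 := ha4; have tk := ht' k
    interval_cases k <;> norm_num <;> linarith
  · intro k hk1 hk4
    have h1 := hc0 1; have h2 := hc0 2; have h3 := hc0 3; have h4 := hc0 4
    interval_cases k <;> norm_num <;> linarith

end Summit.HubbardSuperconductivity.HubbardSuperconductivity.Theorems.EngineV8

end
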